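import Summits.FinalStateConjecture.FinalStateConjecture.Theses.ExactKerrEnds
import Literature.Geometry.Lorentzian.TameBreathingCurve
import Literature.Geometry.Lorentzian.CauchyDevelopmentPrecomp
import Literature.Geometry.Lorentzian.AFEndUnbreathe
import Literature.Geometry.Lorentzian.TameGenericityLocal

/-!
# Line `base-point-reduction` — crux `CensorshipAlongKerrEnds` (stmt-FinalStateConjecture-18521,
# route ExactKerrEnds, rank 3; decl `Summit.FinalStateConjecture.FinalStateConjecture.Theses.ExactKerrEnds.CensorshipAlongKerrEnds`)
# — skeleton v1 (crux-strategist `cstrat-stmt-FinalStateConjecture-18521-b1`, 2026-08-17)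

Crux (FIXED, concluded BY NAME in `CensorshipAlongKerrEnds_of` / `CensorshipAlongKerrEnds_proof`): for every
`X`, end `e` and tame curve `F` of admissible data on `e`, immersed-injective or constant, whose members off
`0` are KERR-ENDED (exact spacelike Kerr leaf outside a compact set), there are `e'` and a tame, injective,
immersed curve `F'` of admissible data with `F' 0 = F 0` whose members off `0` are Kerr-ended AND CENSORED
(every MGHD has complete `𝓘⁺`, sojourn form).

## The lever: `F'` shares only its BASE POINT with `F`

The conclusion ties `F'` to `F` through `F' 0 = F 0` alone, so the crux is decided AT THE BASE DATUM
`d := F 0`; the input curve serves for nothing but the dichotomy "`d` Kerr-ended or not" (a constant curve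
with Kerr-ended members off `0` has a Kerr-ended base). Case on `d`:

* `d` Kerr-ended AND censored — PROVED here (§2, `goodCurveThrough_of_kerrEnded_censored`): the breathing
  curve of `d` (isometric copies `(breathe σ(c))^* d`, `Literature/…/TameBreathingCurve.lean`) is tame,
  injective, immersed, admissible; Kerr-endedness survives modification on a compact set
  (`kerrEnded_of_agree_off_compact`, `K ↦ K ∪ core`) and censoredness survives re-indexing along a
  diffeomorphism (`censored_breatheFamily`, from `VacuumCauchyDevelopment.forall_isMaximal_comap_iff` and
  `hasCompleteFutureNullInfinity_precomp_iff`, `Literature/…/CauchyDevelopmentPrecomp.lean`).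
* `d` Kerr-ended, NOT censored — Stub 2 `stub_christodoulouAtKerrEndedData`: Christodoulou's
  positive-codimension censorship AT ONE Kerr-ended datum, local in the parameter, escape inside the
  Kerr-ended class (his fixed-asymptotics space `𝓐_d`; the compactly supported form is proved sufficient,
  `christodoulouAtKerrEndedData_of_compactSupport`). OPEN (instability half of weak cosmic censorship for
  smooth vacuum data).
* `d` NOT Kerr-ended (then `F` is immersed-injective) — Stub 3 `stub_censoredKerrEndedLanding`: a local
  good escape through the non-Kerr-ended base of a Kerr-ended tame curve ("every tame limit of Kerr-ended
  admissible data is a tame limit of CENSORED Kerr-ended admissible data"). OPEN; this is where the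
  route's "uniformity as the gluing radius `R(c) → ∞`" lives, and ONLY here.
* Bookkeeping — Stub 1 `stub_windowUpgrade`: a tame curve immersed at `0` with the good property on a
  punctured window is upgraded to a tame INJECTIVE immersed curve with the property off `0` (immersion ⇒
  local injectivity of a scalar component ⇒ radial reparametrisation). Provable calculus (size M); it
  relieves both physical stubs of injectivity and of global-in-`c` control.

§6 records that the physical stubs do not over-claim (`christodoulouAtKerrEndedData_of_crux`,
`censoredKerrEndedLanding_of_crux`: each is a consequence of the crux) and that, given Stub 1, the cut is
LOSSLESS (`censorshipAlongKerrEnds_iff_pieces`). Cheap probes (strategist's `work/probes2.lean`, farm rc 1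
with exactly the 9 expected failures): `Stubᵢ → crux` (i = 1, 2, 3), `Stub 1 ∧ Stub 2 → crux`,
`Stub 1 ∧ Stub 3 → crux`, `Stubᵢ` outright, `crux → FinalStateConjecture`, each by
`first | exact? | simpa | aesop` at 400k heartbeats — all FAIL: no costume, both physical stubs load-bearing.

Why each stub might fail (one line each; sources in the line card `Lines/base-point-reduction.md`):
Stub 1 — does not (folklore calculus over `TameGenericity.lean`; the only work is extracting smoothness of a
scalar component from `IsSmoothDataFamily`). Stub 2 — a smooth Kerr-ended vacuum datum whose naked
singularity is STABLE under smooth compactly supported deformations kills it; the one proved mechanism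
(Christodoulou, Ann. Math. 149, Thm. 4.1 = Shlapentokh-Rothman 2025 Thm. 7) needs ROUGH perturbations and at
matched regularity the conclusion reverses (Zheng, arXiv:2605.16235, Thm. 1.3); in C^∞ vacuum no naked
singularity is even constructed (Shlapentokh-Rothman 2025, §4.5 (2)). Stub 3 — needs censoring deformations of
weighted size `→ 0` chosen jointly smoothly along a degenerating family (parametric Christodoulou); fails if
naked Kerr-ended data are accumulated by naked Kerr-ended data along every tame curve through some admissible
base datum.

Disproof used: none exists for this crux yet (`ledger crux ls stmt-FinalStateConjecture-18521`: no
`Disproof.lean`, 2026-08-17T06Z); the sibling disproofs `Cruxes/WeakCosmicCensorshipTame/Disproof.lean` §3–§4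
(constraints, `IsMaximal`, `T2Space` load-bearing; tameness ⇒ mass continuity, burial excluded) are honoured:
every curve here is admissible, tame on one end, and censoredness is read over MAXIMAL developments only.
Dead lines: none registered. Birth skeleton (planner, evidence `CensorshipAlongKerrEnds_birth.lean`): cut by
the SHAPE OF THE INPUT (constant / curve); this line cuts by the BASE DATUM instead, which discharges the
good-base quarter and strips the curve case of every Kerr-ended base.
-/

-- the doubled `FinalStateConjecture.FinalStateConjecture` path component trips dupNamespace
set_option linter.dupNamespace false

noncomputable section

open scoped Manifold ContDiff Topology
open Set Function Filter TopologicalSpace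

namespace Summit.FinalStateConjecture.FinalStateConjecture.Cruxes.CensorshipAlongKerrEnds.BasePointReduction

open Literature.Geometry.Lorentzian
open Summit.FinalStateConjecture.FinalStateConjecture.Theses.ExactKerrEnds (CensorshipAlongKerrEnds)

/-! ## §1 The two properties of a datum (short forms of the crux's let-bound legend) -/
section Properties

variable {X : Type} [TopologicalSpace X] [ChartedSpace E3 X] [IsManifold (𝓡 3) ∞ X] [T2Space X]
  [SecondCountableTopology X] [ConnectedSpace X]

/-- `KerrEnded D` — outside a compact set `D` is an exact spacelike leaf of a Kerr chart (verbatim the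
crux's let-bound legend). [cite: CorvinoSchoen2006, Thm. 5] -/
def KerrEnded (D : InitialDataSet (𝓡 3) X) : Prop :=
  ∀ [Kerr.Facts], ∃ (K : Set X) (U : Opens E3) (M a r₀ : ℝ) (hM : 0 ≤ M) (φ : U → X)
    (ψ : U → Kerr.region a r₀) (ν : NormalField 𝓘(ℝ, E4) ψ),
    IsCompact K ∧ Kᶜ ⊆ range φ ∧ Topology.IsOpenEmbedding φ ∧
      ContMDiff 𝓘(ℝ, E3) (𝓡 3) ((⊤ : ℕ∞) : WithTop ℕ∞) φ ∧ Injective ψ ∧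
      (Kerr.smoothMetric M a r₀).IsSpacelikeImmersion 𝓘(ℝ, E3) ψ ∧
      (Kerr.smoothMetric M a r₀).IsFutureUnitNormal 𝓘(ℝ, E3)
        ((Kerr.timeOrientation M a r₀ hM).ofLE le_top) ψ ν ∧
      (∀ (y : U) (v w : E3), φ y ∉ K →
        D.h.inner (φ y) (mfderiv 𝓘(ℝ, E3) (𝓡 3) φ y v) (mfderiv 𝓘(ℝ, E3) (𝓡 3) φ y w) =
          Kerr.bilin M a (ψ y : E4) (mfderiv 𝓘(ℝ, E3) 𝓘(ℝ, E4) ψ y v)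
            (mfderiv 𝓘(ℝ, E3) 𝓘(ℝ, E4) ψ y w)) ∧
      (∀ [(Kerr.smoothMetric M a r₀).HasLeviCivita] (y : U) (v w : E3), φ y ∉ K →
        D.k (φ y) (mfderiv 𝓘(ℝ, E3) (𝓡 3) φ y v) (mfderiv 𝓘(ℝ, E3) (𝓡 3) φ y w) =
          (Kerr.smoothMetric M a r₀).secondFundamentalForm 𝓘(ℝ, E3) ψ ν y v w)

/-- `Censored D` — every maximal vacuum Cauchy development of `D` has complete future null infinity
(sojourn form). [cite: Christodoulou1999, pp. A26–A27] -/
def Censored (D : InitialDataSet (𝓡 3) X) : Prop :=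
  ∀ 𝒟 : VacuumCauchyDevelopment D, 𝒟.IsMaximal →
    Summit.FinalStateConjecture.HasCompleteNullInfinity 𝒟.toCauchyDevelopment

/-- The conclusion shape of the crux at a base datum `d`: an end and a tame, injective, immersed curve of
admissible data through `d` whose members off `0` are Kerr-ended and censored. -/
def GoodCurveThrough (d : InitialDataSet (𝓡 3) X) : Prop :=
  ∃ (e' : AFEnd X) (F' : EuclideanSpace ℝ (Fin 1) → InitialDataSet (𝓡 3) X),
    InitialDataSet.IsTameDataFamily e' 1 F' ∧ F' 0 = d ∧ Injective F' ∧
      InitialDataSet.IsImmersedAtZero 1 F' ∧ (∀ c, F' c ∈ admissibleVacuumData X) ∧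
        ∀ c ≠ 0, KerrEnded (F' c) ∧ Censored (F' c)

/-- A LOCAL good escape through `d` (no injectivity, members controlled on a punctured window only):
the output shape asked of the two physical stubs. -/
def LocalEscape (d : InitialDataSet (𝓡 3) X) : Prop :=
  ∃ (e' : AFEnd X) (F' : EuclideanSpace ℝ (Fin 1) → InitialDataSet (𝓡 3) X),
    InitialDataSet.IsTameDataFamily e' 1 F' ∧ InitialDataSet.IsImmersedAtZero 1 F' ∧ F' 0 = d ∧
      ∃ ε > (0 : ℝ), ∀ c, c ≠ 0 → ‖c‖ < ε →
        F' c ∈ admissibleVacuumData X ∧ KerrEnded (F' c) ∧ Censored (F' c)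

end Properties

/-- **Read-back.** The crux is: for every `X`, end `e` and tame curve `F` of admissible data on `e`,
immersed-injective or constant, with Kerr-ended members off `0`, there is a good curve through `F 0`
(definitional). [folklore] -/
theorem censorshipAlongKerrEnds_iff :
    CensorshipAlongKerrEnds ↔
      ∀ (X : Type) [TopologicalSpace X] [ChartedSpace E3 X] [IsManifold (𝓡 3) ∞ X] [T2Space X]
        [SecondCountableTopology X] [ConnectedSpace X],
        ∀ (e : AFEnd X) (F : EuclideanSpace ℝ (Fin 1) → InitialDataSet (𝓡 3) X),
          InitialDataSet.IsTameDataFamily e 1 F →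
            ((InitialDataSet.IsImmersedAtZero 1 F ∧ Injective F) ∨ ∀ c, F c = F 0) →
              (∀ c, F c ∈ admissibleVacuumData X) → (∀ c ≠ 0, KerrEnded (F c)) →
                GoodCurveThrough (F 0) :=
  Iff.rfl


/-! ## §2 PROVED: the good-base case — Kerr-endedness survives compact modifications, censoredness survives
isometric re-indexing, so the BREATHING CURVE of a Kerr-ended censored admissible datum is a good curve -/
section GoodBase

variable {X : Type} [TopologicalSpace X] [ChartedSpace E3 X] [IsManifold (𝓡 3) ∞ X] [T2Space X]
  [SecondCountableTopology X] [ConnectedSpace X]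

omit [T2Space X] [SecondCountableTopology X] [ConnectedSpace X] in
/-- **Kerr-endedness is stable under modification on a compact set**: if `D'` agrees with the Kerr-ended
datum `d` (same metric, same second fundamental form) off the compact `K₀`, then `D'` is Kerr-ended
with the same chart and the enlarged exceptional compact `K ∪ K₀`. [folklore] -/
theorem kerrEnded_of_agree_off_compact {d D' : InitialDataSet (𝓡 3) X} (hd : KerrEnded d)
    {K₀ : Set X} (hK₀ : IsCompact K₀)
    (hagree : ∀ x ∉ K₀, D'.h.inner x = d.h.inner x ∧ D'.k x = d.k x) : KerrEnded D' := by
  intro inst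
  obtain ⟨K, U, M, a, r₀, hM, φ, ψ, ν, hK, hKc, hφo, hφs, hψ, hsp, hun, hh, hk⟩ := @hd inst
  refine ⟨K ∪ K₀, U, M, a, r₀, hM, φ, ψ, ν, hK.union hK₀, ?_, hφo, hφs, hψ, hsp, hun, ?_, ?_⟩
  · intro x hx
    exact hKc fun h ↦ hx (Or.inl h)
  · intro y v w hy
    have hyK : φ y ∉ K := fun h ↦ hy (Or.inl h)
    have hyK₀ : φ y ∉ K₀ := fun h ↦ hy (Or.inr h)
    rw [(hagree _ hyK₀).1]
    exact hh y v w hyK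
  · intro instLC y v w hy
    have hyK : φ y ∉ K := fun h ↦ hy (Or.inl h)
    have hyK₀ : φ y ∉ K₀ := fun h ↦ hy (Or.inr h)
    rw [(hagree _ hyK₀).2]
    exact hk y v w hyK

omit [IsManifold (𝓡 3) ∞ X] [T2Space X] [SecondCountableTopology X] [ConnectedSpace X] in
/-- The differentials of the inverse of a both-ways-smooth homeomorphism are injective (chain rule
against `Φ ∘ Φ⁻¹ = id`). [folklore] -/
theorem injective_mfderiv_homeomorph_symm (Φ : X ≃ₜ X)
    (hΦ : ContMDiff (𝓡 3) (𝓡 3) (∞ + 1) Φ) (hΨ : ContMDiff (𝓡 3) (𝓡 3) (∞ + 1) Φ.symm) (u : X) :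
    Injective (mfderiv (𝓡 3) (𝓡 3) Φ.symm u) := by
  have hd1 : MDifferentiableAt (𝓡 3) (𝓡 3) Φ (Φ.symm u) :=
    (hΦ.of_le le_self_add).mdifferentiableAt (by simp)
  have hd2 : MDifferentiableAt (𝓡 3) (𝓡 3) Φ.symm u :=
    (hΨ.of_le le_self_add).mdifferentiableAt (by simp)
  have hcomp : HasMFDerivAt (𝓡 3) (𝓡 3) (⇑Φ ∘ ⇑Φ.symm) u
      ((mfderiv (𝓡 3) (𝓡 3) Φ (Φ.symm u)).comp (mfderiv (𝓡 3) (𝓡 3) Φ.symm u)) :=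
    hd1.hasMFDerivAt.comp u hd2.hasMFDerivAt
  have hid : HasMFDerivAt (𝓡 3) (𝓡 3) (⇑Φ ∘ ⇑Φ.symm) u
      (ContinuousLinearMap.id ℝ (TangentSpace (𝓡 3) u)) := by
    have h := hasMFDerivAt_id (I := 𝓡 3) u
    exact h.congr_of_eventuallyEq (Eventually.of_forall fun x ↦ Φ.apply_symm_apply x)
  have heq : (mfderiv (𝓡 3) (𝓡 3) Φ (Φ.symm u)).comp (mfderiv (𝓡 3) (𝓡 3) Φ.symm u) =
      ContinuousLinearMap.id ℝ (TangentSpace (𝓡 3) u) :=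
    hcomp.mfderiv.symm.trans hid.mfderiv
  intro v w hvw
  have h := congrArg (mfderiv (𝓡 3) (𝓡 3) Φ (Φ.symm u)) hvw
  rw [← ContinuousLinearMap.comp_apply, ← ContinuousLinearMap.comp_apply, heq] at h
  exact h

variable {e : AFEnd X} {z₀ : E3} {r : ℝ} (B : AFEnd.BreathingData e z₀ r) (d : InitialDataSet (𝓡 3) X)

omit [SecondCountableTopology X] in
/-- **Censoredness passes from `d` to every member of its breathing family**: the member
`E_t = (breathe (σ t))^* d` is `d` re-indexed along a diffeomorphism of `X`, and "every MGHD has complete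
`𝓘⁺`" is invariant under re-indexing (`VacuumCauchyDevelopment.forall_isMaximal_comap_iff`,
`hasCompleteFutureNullInfinity_precomp_iff`). [cite: Christodoulou1999, pp. A26–A27] -/
theorem censored_breatheFamily (t : ℝ) (hC : Censored d) : Censored (AFEnd.breatheFamily B d t) := by
  set Φ : X ≃ₜ X := AFEnd.breatheHomeomorph B (AFEnd.abs_squash_lt_invScale B t) with hΦdef
  have hΦ : ContMDiff (𝓡 3) (𝓡 3) (∞ + 1) Φ :=
    AFEnd.contMDiff_breathe_succ B (AFEnd.abs_squash_lt_scale B t).2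
  have hΦ' : ∀ u, Injective (mfderiv (𝓡 3) (𝓡 3) Φ u) :=
    (AFEnd.breatheScale_spec B).2.2 _ (AFEnd.abs_squash_lt_scale B t).1
  have hΨ : ContMDiff (𝓡 3) (𝓡 3) (∞ + 1) Φ.symm := AFEnd.contMDiff_unbreathe B _
  have hΨ' : ∀ u, Injective (mfderiv (𝓡 3) (𝓡 3) Φ.symm u) :=
    injective_mfderiv_homeomorph_symm Φ hΦ hΨ
  have key : AFEnd.breatheFamily B d t = d.comap Φ hΦ hΦ' := rfl
  rw [key]
  exact (VacuumCauchyDevelopment.forall_isMaximal_comap_iff Φ hΦ hΦ' hΨ hΨ'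
    (fun {D'} 𝒟 ↦ ∀ [𝒟.metric.HasLeviCivita],
      𝒟.metric.HasCompleteFutureNullInfinity 𝒟.timeOrientation 𝒟.embed 𝒟.normal)
    fun 𝒟 Θ hΘ hΘ' ↦ VacuumCauchyDevelopment.hasCompleteFutureNullInfinity_precomp_iff 𝒟 Θ hΘ hΘ').2 hC

omit [SecondCountableTopology X] [ConnectedSpace X] in
/-- **Kerr-endedness passes from `d` to every member of its breathing family** (the member agrees with
`d` off the compact core). [folklore] -/
theorem kerrEnded_breatheFamily (t : ℝ) (hK : KerrEnded d) : KerrEnded (AFEnd.breatheFamily B d t) :=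
  kerrEnded_of_agree_off_compact hK (AFEnd.isCompact_breatheCore B)
    fun _ hx ↦ AFEnd.breatheFamily_eq_of_not_mem_core B d t hx

/-- **The good-base case of the crux, PROVED.** Through every admissible datum that is Kerr-ended AND
censored passes a tame, injective, immersed curve of admissible data whose members (all of them) are
Kerr-ended and censored: the breathing curve of `d` on a coordinate ball far out on its sole end, read on
a collared restriction of that end (`InitialDataSet.exists_tame_selfWitness` technology,
`TameBreathingCurve.lean`), along which Kerr-endedness and censoredness transfer
(`kerrEnded_breatheFamily`, `censored_breatheFamily`). [cite: Christodoulou1999, p. A24] -/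
theorem goodCurveThrough_of_kerrEnded_censored {d : InitialDataSet (𝓡 3) X}
    (hd : d ∈ admissibleVacuumData X) (hK : KerrEnded d) (hC : Censored d) : GoodCurveThrough d := by
  obtain ⟨-, e₀, M, hsole, hdecay⟩ := id hd
  -- a breathing ball far out on the sole end of `d`
  set z₁ : E3 := (e₀.R + 3) • EuclideanSpace.single (0 : Fin 3) (1 : ℝ) with hz₁
  have hz₁n : ‖z₁‖ = e₀.R + 3 := by
    rw [hz₁, norm_smul, PiLp.norm_single, norm_one, mul_one,
      Real.norm_of_nonneg (by linarith [e₀.R_pos])]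
  have B₁ : e₀.BreathingData z₁ 1 := ⟨one_pos, by rw [hz₁n]; linarith⟩
  have hR₁ : e₀.R < e₀.R + 1 := by linarith
  exact ⟨e₀.restrict hR₁.le, fun c ↦ AFEnd.breatheFamily B₁ d (c 0),
    AFEnd.isTameDataFamily_restrict_breatheCurve B₁ d hsole hdecay hR₁,
    AFEnd.breatheCurve_zero B₁ d, AFEnd.injective_breatheCurve B₁ d,
    AFEnd.isImmersedAtZero_breatheCurve B₁ d,
    fun c ↦ AFEnd.breatheCurve_mem_admissibleVacuumData B₁ d hd c,
    fun c _ ↦ ⟨kerrEnded_breatheFamily B₁ d (c 0) hK, censored_breatheFamily B₁ d (c 0) hC⟩⟩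

end GoodBase


/-! ## §3 Short forms of the three stubs -/
section ShortForms

/-- Stub 1, short form: WINDOW UPGRADE — a tame curve immersed at `0` whose members with `0 < ‖c‖ < ε`
satisfy `P` is replaced by a tame, INJECTIVE, immersed curve through the same base datum on the same end
all of whose members off `0` satisfy `P` (local injectivity from immersion, then radial reparametrisation). -/
def WindowUpgrade : Prop :=
  ∀ (X : Type) [TopologicalSpace X] [ChartedSpace E3 X] [IsManifold (𝓡 3) ∞ X] [T2Space X]
    [SecondCountableTopology X] [ConnectedSpace X],
    ∀ (P : InitialDataSet (𝓡 3) X → Prop) (e : AFEnd X) (F : EuclideanSpace ℝ (Fin 1) → InitialDataSet (𝓡 3) X),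
      InitialDataSet.IsTameDataFamily e 1 F → InitialDataSet.IsImmersedAtZero 1 F →
        (∃ ε > (0 : ℝ), ∀ c, c ≠ 0 → ‖c‖ < ε → P (F c)) →
          ∃ F' : EuclideanSpace ℝ (Fin 1) → InitialDataSet (𝓡 3) X,
            InitialDataSet.IsTameDataFamily e 1 F' ∧ F' 0 = F 0 ∧ Injective F' ∧
              InitialDataSet.IsImmersedAtZero 1 F' ∧ ∀ c ≠ 0, P (F' c)

/-- Stub 2, short form: CHRISTODOULOU AT KERR-ENDED DATA — a local good escape through every admissible
Kerr-ended datum that is NOT censored. -/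
def ChristodoulouAtKerrEndedData : Prop :=
  ∀ (X : Type) [TopologicalSpace X] [ChartedSpace E3 X] [IsManifold (𝓡 3) ∞ X] [T2Space X]
    [SecondCountableTopology X] [ConnectedSpace X],
    ∀ d ∈ admissibleVacuumData X, KerrEnded d → ¬ Censored d → LocalEscape d

/-- Stub 3, short form: CENSORED KERR-ENDED LANDING — a local good escape through the NON-Kerr-ended base
datum of a tame, immersed, injective admissible curve whose members off `0` are Kerr-ended. -/
def CensoredKerrEndedLanding : Prop :=
  ∀ (X : Type) [TopologicalSpace X] [ChartedSpace E3 X] [IsManifold (𝓡 3) ∞ X] [T2Space X]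
    [SecondCountableTopology X] [ConnectedSpace X],
    ∀ (e : AFEnd X) (F : EuclideanSpace ℝ (Fin 1) → InitialDataSet (𝓡 3) X),
      InitialDataSet.IsTameDataFamily e 1 F → InitialDataSet.IsImmersedAtZero 1 F → Injective F →
        (∀ c, F c ∈ admissibleVacuumData X) → (∀ c ≠ 0, KerrEnded (F c)) → ¬ KerrEnded (F 0) →
          LocalEscape (F 0)

end ShortForms

/-! ### Statements of the registered stubs, under the stub names -/
namespace Goal

/-- Statement of `stub_windowUpgrade`. -/
abbrev stub_windowUpgrade : Prop := WindowUpgrade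
/-- Statement of `stub_christodoulouAtKerrEndedData`. -/
abbrev stub_christodoulouAtKerrEndedData : Prop := ChristodoulouAtKerrEndedData
/-- Statement of `stub_censoredKerrEndedLanding`. -/
abbrev stub_censoredKerrEndedLanding : Prop := CensoredKerrEndedLanding

end Goal

/-! ## §4 Registered stubs (the only `sorry`s of the file), stated EXPANDED over importable declarations
with the crux's let-bound legend verbatim, so that `--supports` files and items can state them without
importing this module. Each IS its short form of §3 definitionally (`*_iff`, `Iff.rfl`). -/

/-- **Stub 1 `stub_windowUpgrade` — WINDOW UPGRADE (tame-genericity calculus; provable bookkeeping,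
size M).** For every property `P` of data, a one-parameter family `F` tame on the end `e` and immersed at
`0` whose members with `0 < ‖c‖ < ε` satisfy `P` is replaced by a family `F'` tame on `e`, injective,
immersed at `0`, with `F' 0 = F 0`, all of whose members off `0` satisfy `P`. Route: immersion at `0`
gives a scalar component `c ↦ h_c(x)(u, w)` (or `k_c`) with non-zero derivative at `0`, smooth by joint
smoothness, hence strictly monotone on a window — local injectivity; then the radial reparametrisation
into that window (`exists_contDiff_radialContraction`, `IsTameDataFamily.comp_contDiff`,
`IsImmersedAtZero.comp_of_injective_fderiv`; cf. `InitialDataSet.exists_tameFamily_of_local`, which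
assumes injectivity instead of deriving it). [cite: Christodoulou1999, p. A24] -/
theorem stub_windowUpgrade :
    ∀ (X : Type) [TopologicalSpace X] [ChartedSpace Literature.Geometry.Lorentzian.E3 X] [IsManifold (𝓡 3) ((⊤ : ℕ∞) : WithTop ℕ∞) X] [T2Space X] [SecondCountableTopology X] [ConnectedSpace X], ∀ (P : Literature.Geometry.Lorentzian.InitialDataSet (𝓡 3) X → Prop) (e : Literature.Geometry.Lorentzian.AFEnd X) (F : EuclideanSpace ℝ (Fin 1) → Literature.Geometry.Lorentzian.InitialDataSet (𝓡 3) X), Literature.Geometry.Lorentzian.InitialDataSet.IsTameDataFamily e 1 F → Literature.Geometry.Lorentzian.InitialDataSet.IsImmersedAtZero 1 F → (∃ ε > (0 : ℝ), ∀ c, c ≠ 0 → ‖c‖ < ε → P (F c)) → ∃ F' : EuclideanSpace ℝ (Fin 1) → Literature.Geometry.Lorentzian.InitialDataSet (𝓡 3) X, Literature.Geometry.Lorentzian.InitialDataSet.IsTameDataFamily e 1 F' ∧ F' 0 = F 0 ∧ Function.Injective F' ∧ Literature.Geometry.Lorentzian.InitialDataSet.IsImmersedAtZero 1 F' ∧ ∀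 c ≠ 0, P (F' c) := by
  sorry

/-- **Stub 2 `stub_christodoulouAtKerrEndedData` — CHRISTODOULOU'S POSITIVE-CODIMENSION CENSORSHIP AT
KERR-ENDED DATA (local in the parameter; OPEN — the instability-of-naked-singularities half of weak cosmic
censorship, for smooth vacuum data with an exact Kerr end).** Through every admissible datum which is an
exact Kerr leaf outside a compact set and one of whose maximal vacuum Cauchy developments has INCOMPLETE
future null infinity passes a one-parameter family `F'`, tame on some end, immersed at `0`, `F' 0 = d`,
whose members with `0 < ‖c‖ < ε` are admissible, Kerr-ended and censored. The compactly supported form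
(Christodoulou's fixed-asymptotics space `𝓐_d`: members agreeing with `d` off one compact set) suffices,
`christodoulouAtKerrEndedData_of_compactSupport` (§6, proved). No theorem of this kind exists outside
spherical symmetry; the one proved mechanism (Christodoulou, Ann. Math. 149, Thm. 4.1: blue-shift
instability under ROUGH perturbations) is unavailable for smooth tame families, and at matched low
regularity the conclusion reverses (Zheng, arXiv:2605.16235, Thm. 1.3).
[cite: Christodoulou1999, p. A24] [cite: Christodoulou1999instability, Thm. 4.1] -/
theorem stub_christodoulouAtKerrEndedData :
    ∀ (X : Type) [TopologicalSpace X] [ChartedSpace Literature.Geometry.Lorentzian.E3 X] [IsManifold (𝓡 3) ((⊤ : ℕ∞) : WithTop ℕ∞) X] [T2Space X] [SecondCountableTopology X] [ConnectedSpace X], let KerrEnded : Literature.Geometry.Lorentzian.InitialDataSet (𝓡 3) X → Prop := fun D ↦ ∀ [Literature.Geometry.Lorentzian.Kerr.Facts], ∃ (K : Set X) (U : Opens Literature.Geometry.Lorentzian.E3) (M a r₀ : ℝ) (hM : 0 ≤ M) (φ : U → X) (ψ : U → Literature.Geometry.Lorentzian.Kerr.region a r₀) (ν : Literature.Geometry.Lorentzian.NormalField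 𝓘(ℝ, Literature.Geometry.Lorentzian.E4) ψ), IsCompact K ∧ Kᶜ ⊆ range φ ∧ Topology.IsOpenEmbedding φ ∧ ContMDiff 𝓘(ℝ, Literature.Geometry.Lorentzian.E3) (𝓡 3) ((⊤ : ℕ∞) : WithTop ℕ∞) φ ∧ Injective ψ ∧ (Literature.Geometry.Lorentzian.Kerr.smoothMetric M a r₀).IsSpacelikeImmersion 𝓘(ℝ, Literature.Geometry.Lorentzian.E3) ψ ∧ (Literature.Geometry.Lorentzian.Kerr.smoothMetric M a r₀).IsFutureUnitNormal 𝓘(ℝ, Literature.Geometry.Lorentzian.E3) ((Literature.Geometry.Lorentzian.Kerr.timeOrientation M a r₀ hM).ofLE le_top) ψ ν ∧ (∀ (y : U) (v w : Literature.Geometry.Lorentzian.E3), φ y ∉ K → D.h.inner (φ y) (mfderiv 𝓘(ℝ, Literature.Geometry.Lorentzian.E3) (𝓡 3) φ y v) (mfderiv 𝓘(ℝ, Literature.Geometry.Lorentzian.E3) (𝓡 3) φ y w) = Literature.Geometry.Lorentzian.Kerr.bilin M a (ψ y : Literature.Geometry.Lorentzian.E4) (mfderiv 𝓘(ℝ,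 Literature.Geometry.Lorentzian.E3) 𝓘(ℝ, Literature.Geometry.Lorentzian.E4) ψ y v) (mfderiv 𝓘(ℝ, Literature.Geometry.Lorentzian.E3) 𝓘(ℝ, Literature.Geometry.Lorentzian.E4) ψ y w)) ∧ (∀ [(Literature.Geometry.Lorentzian.Kerr.smoothMetric M a r₀).HasLeviCivita] (y : U) (v w : Literature.Geometry.Lorentzian.E3), φ y ∉ K → D.k (φ y) (mfderiv 𝓘(ℝ, Literature.Geometry.Lorentzian.E3) (𝓡 3) φ y v) (mfderiv 𝓘(ℝ, Literature.Geometry.Lorentzian.E3) (𝓡 3) φ y w) = (Literature.Geometry.Lorentzian.Kerr.smoothMetric M a r₀).secondFundamentalForm 𝓘(ℝ, Literature.Geometry.Lorentzian.E3) ψ ν y v w); let Censored : Literature.Geometry.Lorentzian.InitialDataSet (𝓡 3) X → Prop := fun D ↦ ∀ 𝒟 : Literature.Geometry.Lorentzian.VacuumCauchyDevelopment D, 𝒟.IsMaximal → Summit.FinalStateConjecture.HasCompleteNullInfinity 𝒟.toCauchyDevelopment; ∀ d ∈ Literature.Geometry.Lorentzian.admissibleVacuumData X, KerrEnded d → ¬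 Censored d → ∃ (e' : Literature.Geometry.Lorentzian.AFEnd X) (F' : EuclideanSpace ℝ (Fin 1) → Literature.Geometry.Lorentzian.InitialDataSet (𝓡 3) X), Literature.Geometry.Lorentzian.InitialDataSet.IsTameDataFamily e' 1 F' ∧ Literature.Geometry.Lorentzian.InitialDataSet.IsImmersedAtZero 1 F' ∧ F' 0 = d ∧ ∃ ε > (0 : ℝ), ∀ c, c ≠ 0 → ‖c‖ < ε → F' c ∈ Literature.Geometry.Lorentzian.admissibleVacuumData X ∧ KerrEnded (F' c) ∧ Censored (F' c) := by
  sorry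

/-- **Stub 3 `stub_censoredKerrEndedLanding` — CENSORED KERR-ENDED LANDING (the curve case at a base datum
that is NOT Kerr-ended; OPEN).** For every tame, immersed, injective curve `F` of admissible data on an end
`e` whose members off `0` are Kerr-ended but whose base datum `F 0` is not, there is a one-parameter family
`F'`, tame on some end, immersed at `0`, `F' 0 = F 0`, whose members with `0 < ‖c‖ < ε` are admissible,
Kerr-ended and censored. `F'` shares only its base point with `F`: the hypothesis may be DISCARDED (then
this is "every tame limit of Kerr-ended admissible data is a tame limit of CENSORED Kerr-ended admissible
data") or used member-wise (compactly supported censoring deformations of the `F c`, of weighted size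
`→ 0`, decided in a compact domain of dependence shared by `F c` and `F 0`). Carries Christodoulou's
mechanism in PARAMETRIC form; no theorem in print. [cite: Christodoulou1999, p. A24] [cite: CorvinoSchoen2006, Thm. 5] -/
theorem stub_censoredKerrEndedLanding :
    ∀ (X : Type) [TopologicalSpace X] [ChartedSpace Literature.Geometry.Lorentzian.E3 X] [IsManifold (𝓡 3) ((⊤ : ℕ∞) : WithTop ℕ∞) X] [T2Space X] [SecondCountableTopology X] [ConnectedSpace X], let KerrEnded : Literature.Geometry.Lorentzian.InitialDataSet (𝓡 3) X → Prop := fun D ↦ ∀ [Literature.Geometry.Lorentzian.Kerr.Facts], ∃ (K : Set X) (U : Opens Literature.Geometry.Lorentzian.E3) (M a r₀ : ℝ) (hM : 0 ≤ M) (φ : U → X) (ψ : U → Literature.Geometry.Lorentzian.Kerr.region a r₀) (ν : Literature.Geometry.Lorentzian.NormalField 𝓘(ℝ, Literature.Geometry.Lorentzian.E4) ψ), IsCompact K ∧ Kᶜ ⊆ range φ ∧ Topology.IsOpenEmbedding φ ∧ ContMDiff 𝓘(ℝ, Literature.Geometry.Lorentzian.E3) (𝓡 3) ((⊤ : ℕ∞)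 : WithTop ℕ∞) φ ∧ Injective ψ ∧ (Literature.Geometry.Lorentzian.Kerr.smoothMetric M a r₀).IsSpacelikeImmersion 𝓘(ℝ, Literature.Geometry.Lorentzian.E3) ψ ∧ (Literature.Geometry.Lorentzian.Kerr.smoothMetric M a r₀).IsFutureUnitNormal 𝓘(ℝ, Literature.Geometry.Lorentzian.E3) ((Literature.Geometry.Lorentzian.Kerr.timeOrientation M a r₀ hM).ofLE le_top) ψ ν ∧ (∀ (y : U) (v w : Literature.Geometry.Lorentzian.E3), φ y ∉ K → D.h.inner (φ y) (mfderiv 𝓘(ℝ, Literature.Geometry.Lorentzian.E3) (𝓡 3) φ y v) (mfderiv 𝓘(ℝ, Literature.Geometry.Lorentzian.E3) (𝓡 3) φ y w) = Literature.Geometry.Lorentzian.Kerr.bilin M a (ψ y : Literature.Geometry.Lorentzian.E4) (mfderiv 𝓘(ℝ, Literature.Geometry.Lorentzian.E3) 𝓘(ℝ, Literature.Geometry.Lorentzian.E4) ψ y v) (mfderiv 𝓘(ℝ, Literature.Geometry.Lorentzian.E3) 𝓘(ℝ, Literature.Geometry.Lorentzian.E4) ψ y w)) ∧ (∀ [(Literature.Geometry.Lorentzian.Kerr.smoothMetric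 M a r₀).HasLeviCivita] (y : U) (v w : Literature.Geometry.Lorentzian.E3), φ y ∉ K → D.k (φ y) (mfderiv 𝓘(ℝ, Literature.Geometry.Lorentzian.E3) (𝓡 3) φ y v) (mfderiv 𝓘(ℝ, Literature.Geometry.Lorentzian.E3) (𝓡 3) φ y w) = (Literature.Geometry.Lorentzian.Kerr.smoothMetric M a r₀).secondFundamentalForm 𝓘(ℝ, Literature.Geometry.Lorentzian.E3) ψ ν y v w); let Censored : Literature.Geometry.Lorentzian.InitialDataSet (𝓡 3) X → Prop := fun D ↦ ∀ 𝒟 : Literature.Geometry.Lorentzian.VacuumCauchyDevelopment D, 𝒟.IsMaximal → Summit.FinalStateConjecture.HasCompleteNullInfinity 𝒟.toCauchyDevelopment; ∀ (e : Literature.Geometry.Lorentzian.AFEnd X) (F : EuclideanSpace ℝ (Fin 1) → Literature.Geometry.Lorentzian.InitialDataSet (𝓡 3) X), Literature.Geometry.Lorentzian.InitialDataSet.IsTameDataFamily e 1 F → Literature.Geometry.Lorentzian.InitialDataSet.IsImmersedAtZero 1 F → Function.Injective F → (∀ c, F c ∈ Literature.Geometry.Lorentzian.admissibleVacuumData X)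 → (∀ c ≠ 0, KerrEnded (F c)) → ¬ KerrEnded (F 0) → ∃ (e' : Literature.Geometry.Lorentzian.AFEnd X) (F' : EuclideanSpace ℝ (Fin 1) → Literature.Geometry.Lorentzian.InitialDataSet (𝓡 3) X), Literature.Geometry.Lorentzian.InitialDataSet.IsTameDataFamily e' 1 F' ∧ Literature.Geometry.Lorentzian.InitialDataSet.IsImmersedAtZero 1 F' ∧ F' 0 = F 0 ∧ ∃ ε > (0 : ℝ), ∀ c, c ≠ 0 → ‖c‖ < ε → F' c ∈ Literature.Geometry.Lorentzian.admissibleVacuumData X ∧ KerrEnded (F' c) ∧ Censored (F' c) := by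
  sorry

/-- Stub 1 IS its short form. [folklore] -/
theorem stub_windowUpgrade_iff : Goal.stub_windowUpgrade ↔
    ∀ (X : Type) [TopologicalSpace X] [ChartedSpace Literature.Geometry.Lorentzian.E3 X] [IsManifold (𝓡 3) ((⊤ : ℕ∞) : WithTop ℕ∞) X] [T2Space X] [SecondCountableTopology X] [ConnectedSpace X], ∀ (P : Literature.Geometry.Lorentzian.InitialDataSet (𝓡 3) X → Prop) (e : Literature.Geometry.Lorentzian.AFEnd X) (F : EuclideanSpace ℝ (Fin 1) → Literature.Geometry.Lorentzian.InitialDataSet (𝓡 3) X), Literature.Geometry.Lorentzian.InitialDataSet.IsTameDataFamily e 1 F → Literature.Geometry.Lorentzian.InitialDataSet.IsImmersedAtZero 1 F → (∃ ε > (0 : ℝ), ∀ c, c ≠ 0 → ‖c‖ < ε → P (F c)) → ∃ F' : EuclideanSpace ℝ (Fin 1) → Literature.Geometry.Lorentzian.InitialDataSet (𝓡 3) X, Literature.Geometry.Lorentzian.InitialDataSet.IsTameDataFamily e 1 F' ∧ F' 0 = F 0 ∧ Function.Injective F' ∧ Literature.Geometry.Lorentzian.InitialDataSet.IsImmersedAtZero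 1 F' ∧ ∀ c ≠ 0, P (F' c) :=
  Iff.rfl

/-- Stub 2 IS its short form. [folklore] -/
theorem stub_christodoulouAtKerrEndedData_iff : Goal.stub_christodoulouAtKerrEndedData ↔
    ∀ (X : Type) [TopologicalSpace X] [ChartedSpace Literature.Geometry.Lorentzian.E3 X] [IsManifold (𝓡 3) ((⊤ : ℕ∞) : WithTop ℕ∞) X] [T2Space X] [SecondCountableTopology X] [ConnectedSpace X], let KerrEnded : Literature.Geometry.Lorentzian.InitialDataSet (𝓡 3) X → Prop := fun D ↦ ∀ [Literature.Geometry.Lorentzian.Kerr.Facts], ∃ (K : Set X) (U : Opens Literature.Geometry.Lorentzian.E3) (M a r₀ : ℝ) (hM : 0 ≤ M) (φ : U → X) (ψ : U → Literature.Geometry.Lorentzian.Kerr.region a r₀) (ν : Literature.Geometry.Lorentzian.NormalField 𝓘(ℝ, Literature.Geometry.Lorentzian.E4) ψ), IsCompact K ∧ Kᶜ ⊆ range φ ∧ Topology.IsOpenEmbedding φ ∧ ContMDiff 𝓘(ℝ, Literature.Geometry.Lorentzian.E3) (𝓡 3) ((⊤ : ℕ∞) : WithTop ℕ∞) φ ∧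 Injective ψ ∧ (Literature.Geometry.Lorentzian.Kerr.smoothMetric M a r₀).IsSpacelikeImmersion 𝓘(ℝ, Literature.Geometry.Lorentzian.E3) ψ ∧ (Literature.Geometry.Lorentzian.Kerr.smoothMetric M a r₀).IsFutureUnitNormal 𝓘(ℝ, Literature.Geometry.Lorentzian.E3) ((Literature.Geometry.Lorentzian.Kerr.timeOrientation M a r₀ hM).ofLE le_top) ψ ν ∧ (∀ (y : U) (v w : Literature.Geometry.Lorentzian.E3), φ y ∉ K → D.h.inner (φ y) (mfderiv 𝓘(ℝ, Literature.Geometry.Lorentzian.E3) (𝓡 3) φ y v) (mfderiv 𝓘(ℝ, Literature.Geometry.Lorentzian.E3) (𝓡 3) φ y w) = Literature.Geometry.Lorentzian.Kerr.bilin M a (ψ y : Literature.Geometry.Lorentzian.E4) (mfderiv 𝓘(ℝ, Literature.Geometry.Lorentzian.E3) 𝓘(ℝ, Literature.Geometry.Lorentzian.E4) ψ y v) (mfderiv 𝓘(ℝ, Literature.Geometry.Lorentzian.E3) 𝓘(ℝ, Literature.Geometry.Lorentzian.E4) ψ y w)) ∧ (∀ [(Literature.Geometry.Lorentzian.Kerr.smoothMetric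 M a r₀).HasLeviCivita] (y : U) (v w : Literature.Geometry.Lorentzian.E3), φ y ∉ K → D.k (φ y) (mfderiv 𝓘(ℝ, Literature.Geometry.Lorentzian.E3) (𝓡 3) φ y v) (mfderiv 𝓘(ℝ, Literature.Geometry.Lorentzian.E3) (𝓡 3) φ y w) = (Literature.Geometry.Lorentzian.Kerr.smoothMetric M a r₀).secondFundamentalForm 𝓘(ℝ, Literature.Geometry.Lorentzian.E3) ψ ν y v w); let Censored : Literature.Geometry.Lorentzian.InitialDataSet (𝓡 3) X → Prop := fun D ↦ ∀ 𝒟 : Literature.Geometry.Lorentzian.VacuumCauchyDevelopment D, 𝒟.IsMaximal → Summit.FinalStateConjecture.HasCompleteNullInfinity 𝒟.toCauchyDevelopment; ∀ d ∈ Literature.Geometry.Lorentzian.admissibleVacuumData X, KerrEnded d → ¬ Censored d → ∃ (e' : Literature.Geometry.Lorentzian.AFEnd X) (F' : EuclideanSpace ℝ (Fin 1) → Literature.Geometry.Lorentzian.InitialDataSet (𝓡 3) X), Literature.Geometry.Lorentzian.InitialDataSet.IsTameDataFamily e' 1 F' ∧ Literature.Geometry.Lorentzian.InitialDataSet.IsImmersedAtZero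 1 F' ∧ F' 0 = d ∧ ∃ ε > (0 : ℝ), ∀ c, c ≠ 0 → ‖c‖ < ε → F' c ∈ Literature.Geometry.Lorentzian.admissibleVacuumData X ∧ KerrEnded (F' c) ∧ Censored (F' c) :=
  Iff.rfl

/-- Stub 3 IS its short form. [folklore] -/
theorem stub_censoredKerrEndedLanding_iff : Goal.stub_censoredKerrEndedLanding ↔
    ∀ (X : Type) [TopologicalSpace X] [ChartedSpace Literature.Geometry.Lorentzian.E3 X] [IsManifold (𝓡 3) ((⊤ : ℕ∞) : WithTop ℕ∞) X] [T2Space X] [SecondCountableTopology X] [ConnectedSpace X], let KerrEnded : Literature.Geometry.Lorentzian.InitialDataSet (𝓡 3) X → Prop := fun D ↦ ∀ [Literature.Geometry.Lorentzian.Kerr.Facts], ∃ (K : Set X) (U : Opens Literature.Geometry.Lorentzian.E3) (M a r₀ : ℝ) (hM : 0 ≤ M) (φ : U → X) (ψ : U → Literature.Geometry.Lorentzian.Kerr.region a r₀) (ν : Literature.Geometry.Lorentzian.NormalField 𝓘(ℝ, Literature.Geometry.Lorentzian.E4) ψ), IsCompact K ∧ Kᶜ ⊆ range φ ∧ Topology.IsOpenEmbedding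 φ ∧ ContMDiff 𝓘(ℝ, Literature.Geometry.Lorentzian.E3) (𝓡 3) ((⊤ : ℕ∞) : WithTop ℕ∞) φ ∧ Injective ψ ∧ (Literature.Geometry.Lorentzian.Kerr.smoothMetric M a r₀).IsSpacelikeImmersion 𝓘(ℝ, Literature.Geometry.Lorentzian.E3) ψ ∧ (Literature.Geometry.Lorentzian.Kerr.smoothMetric M a r₀).IsFutureUnitNormal 𝓘(ℝ, Literature.Geometry.Lorentzian.E3) ((Literature.Geometry.Lorentzian.Kerr.timeOrientation M a r₀ hM).ofLE le_top) ψ ν ∧ (∀ (y : U) (v w : Literature.Geometry.Lorentzian.E3), φ y ∉ K → D.h.inner (φ y) (mfderiv 𝓘(ℝ, Literature.Geometry.Lorentzian.E3) (𝓡 3) φ y v) (mfderiv 𝓘(ℝ, Literature.Geometry.Lorentzian.E3) (𝓡 3) φ y w) = Literature.Geometry.Lorentzian.Kerr.bilin M a (ψ y : Literature.Geometry.Lorentzian.E4) (mfderiv 𝓘(ℝ, Literature.Geometry.Lorentzian.E3) 𝓘(ℝ, Literature.Geometry.Lorentzian.E4) ψ y v) (mfderiv 𝓘(ℝ, Literature.Geometry.Lorentzian.E3)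 𝓘(ℝ, Literature.Geometry.Lorentzian.E4) ψ y w)) ∧ (∀ [(Literature.Geometry.Lorentzian.Kerr.smoothMetric M a r₀).HasLeviCivita] (y : U) (v w : Literature.Geometry.Lorentzian.E3), φ y ∉ K → D.k (φ y) (mfderiv 𝓘(ℝ, Literature.Geometry.Lorentzian.E3) (𝓡 3) φ y v) (mfderiv 𝓘(ℝ, Literature.Geometry.Lorentzian.E3) (𝓡 3) φ y w) = (Literature.Geometry.Lorentzian.Kerr.smoothMetric M a r₀).secondFundamentalForm 𝓘(ℝ, Literature.Geometry.Lorentzian.E3) ψ ν y v w); let Censored : Literature.Geometry.Lorentzian.InitialDataSet (𝓡 3) X → Prop := fun D ↦ ∀ 𝒟 : Literature.Geometry.Lorentzian.VacuumCauchyDevelopment D, 𝒟.IsMaximal → Summit.FinalStateConjecture.HasCompleteNullInfinity 𝒟.toCauchyDevelopment; ∀ (e : Literature.Geometry.Lorentzian.AFEnd X) (F : EuclideanSpace ℝ (Fin 1) → Literature.Geometry.Lorentzian.InitialDataSet (𝓡 3) X), Literature.Geometry.Lorentzian.InitialDataSet.IsTameDataFamily e 1 F → Literature.Geometry.Lorentzian.InitialDataSet.IsImmersedAtZero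 1 F → Function.Injective F → (∀ c, F c ∈ Literature.Geometry.Lorentzian.admissibleVacuumData X) → (∀ c ≠ 0, KerrEnded (F c)) → ¬ KerrEnded (F 0) → ∃ (e' : Literature.Geometry.Lorentzian.AFEnd X) (F' : EuclideanSpace ℝ (Fin 1) → Literature.Geometry.Lorentzian.InitialDataSet (𝓡 3) X), Literature.Geometry.Lorentzian.InitialDataSet.IsTameDataFamily e' 1 F' ∧ Literature.Geometry.Lorentzian.InitialDataSet.IsImmersedAtZero 1 F' ∧ F' 0 = F 0 ∧ ∃ ε > (0 : ℝ), ∀ c, c ≠ 0 → ‖c‖ < ε → F' c ∈ Literature.Geometry.Lorentzian.admissibleVacuumData X ∧ KerrEnded (F' c) ∧ Censored (F' c) :=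
  Iff.rfl

theorem windowUpgrade_holds : Goal.stub_windowUpgrade := stub_windowUpgrade
theorem christodoulouAtKerrEndedData_holds : Goal.stub_christodoulouAtKerrEndedData :=
  stub_christodoulouAtKerrEndedData
theorem censoredKerrEndedLanding_holds : Goal.stub_censoredKerrEndedLanding :=
  stub_censoredKerrEndedLanding

/-! ## §5 The composition (sorry-free): the crux BY NAME from the three stubs -/
section Composition

variable {X : Type} [TopologicalSpace X] [ChartedSpace E3 X] [IsManifold (𝓡 3) ∞ X] [T2Space X]
  [SecondCountableTopology X] [ConnectedSpace X]

/-- **A local good escape through an admissible datum is upgraded to a good curve** (window upgrade with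
`P D := D ∈ 𝓓 ∧ KerrEnded D ∧ Censored D`; the base member is admissible by hypothesis). [folklore] -/
theorem goodCurveThrough_of_localEscape (h₁ : Goal.stub_windowUpgrade) {d : InitialDataSet (𝓡 3) X}
    (hd : d ∈ admissibleVacuumData X) (hL : LocalEscape d) : GoodCurveThrough d := by
  obtain ⟨e', F', hF', himm', h0', ε, hε, hP⟩ := hL
  obtain ⟨F'', hF'', h0'', hinj, himm'', hP''⟩ :=
    h₁ X (fun D ↦ D ∈ admissibleVacuumData X ∧ KerrEnded D ∧ Censored D) e' F' hF' himm' ⟨ε, hε, hP⟩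
  refine ⟨e', F'', hF'', h0''.trans h0', hinj, himm'', fun c ↦ ?_, fun c hc ↦ (hP'' c hc).2⟩
  by_cases hc : c = 0
  · rw [hc, h0'', h0']
    exact hd
  · exact (hP'' c hc).1

omit [T2Space X] [SecondCountableTopology X] [ConnectedSpace X] in
/-- A constant curve whose members off `0` have a property has it at the base (`ℝ¹` has a non-zero
vector). [folklore] -/
theorem base_of_const {F : EuclideanSpace ℝ (Fin 1) → InitialDataSet (𝓡 3) X}
    {Q : InitialDataSet (𝓡 3) X → Prop} (hconst : ∀ c, F c = F 0) (hQ : ∀ c ≠ 0, Q (F c)) : Q (F 0) := by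
  have hc : (EuclideanSpace.single (0 : Fin 1) (1 : ℝ) : EuclideanSpace ℝ (Fin 1)) ≠ 0 := by
    rw [← norm_ne_zero_iff, PiLp.norm_single, norm_one]
    exact one_ne_zero
  rw [← hconst (EuclideanSpace.single (0 : Fin 1) (1 : ℝ))]
  exact hQ _ hc

end Composition

/-- **The crux from the three stubs, by cases on the BASE DATUM `d = F 0` only** (the input curve is
consulted for nothing but the dichotomy): `d` Kerr-ended and censored ⇒ its breathing curve
(`goodCurveThrough_of_kerrEnded_censored`, PROVED); `d` Kerr-ended, not censored ⇒ Stub 2 then Stub 1;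
`d` not Kerr-ended ⇒ the curve is not constant, hence immersed and injective, and Stub 3 then Stub 1.
[folklore] -/
theorem censorshipAlongKerrEnds_of_pieces (h₁ : Goal.stub_windowUpgrade)
    (h₂ : Goal.stub_christodoulouAtKerrEndedData) (h₃ : Goal.stub_censoredKerrEndedLanding) :
    CensorshipAlongKerrEnds := by
  rw [censorshipAlongKerrEnds_iff]
  intro X _ _ _ _ _ _ e F hF hdich h𝓓 hKE
  have hd : F 0 ∈ admissibleVacuumData X := h𝓓 0
  by_cases hK : KerrEnded (F 0)
  · by_cases hC : Censored (F 0)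
    · exact goodCurveThrough_of_kerrEnded_censored hd hK hC
    · exact goodCurveThrough_of_localEscape h₁ hd (h₂ X (F 0) hd hK hC)
  · have himm_inj : InitialDataSet.IsImmersedAtZero 1 F ∧ Injective F := by
      rcases hdich with h | h
      · exact h
      · exact (hK (base_of_const (Q := KerrEnded) h hKE)).elim
    exact goodCurveThrough_of_localEscape h₁ hd (h₃ X e F hF himm_inj.1 himm_inj.2 h𝓓 hKE hK)

/-- **The crux BY NAME from the registered stubs.** -/
theorem CensorshipAlongKerrEnds_of :
    Goal.stub_windowUpgrade → Goal.stub_christodoulouAtKerrEndedData → Goal.stub_censoredKerrEndedLanding →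
      Summit.FinalStateConjecture.FinalStateConjecture.Theses.ExactKerrEnds.CensorshipAlongKerrEnds :=
  censorshipAlongKerrEnds_of_pieces

/-- **Skeleton conclusion in the registry's shape.** -/
theorem CensorshipAlongKerrEnds_proof :
    Summit.FinalStateConjecture.FinalStateConjecture.Theses.ExactKerrEnds.CensorshipAlongKerrEnds :=
  CensorshipAlongKerrEnds_of stub_windowUpgrade stub_christodoulouAtKerrEndedData
    stub_censoredKerrEndedLanding

/-! ## §6 Records: the physical stubs do not over-claim (each is a consequence of the crux), so modulo the
bookkeeping Stub 1 the cut `Stub 2 ∧ Stub 3 ⟹ crux` is LOSSLESS; and the compactly supported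
(Christodoulou `𝓐_d`) form of Stub 2 suffices. -/
section Records

variable {X : Type} [TopologicalSpace X] [ChartedSpace E3 X] [IsManifold (𝓡 3) ∞ X] [T2Space X]
  [SecondCountableTopology X] [ConnectedSpace X]

omit [T2Space X] [SecondCountableTopology X] in
/-- A good curve through `d` is in particular a local escape (`ε = 1`). [folklore] -/
theorem localEscape_of_goodCurveThrough {d : InitialDataSet (𝓡 3) X} (h : GoodCurveThrough d) :
    LocalEscape d := by
  obtain ⟨e', F', hF', h0', -, himm', h𝓓', hP⟩ := h
  exact ⟨e', F', hF', himm', h0', 1, one_pos, fun c hc _ ↦ ⟨h𝓓' c, hP c hc⟩⟩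

end Records

/-- Stub 2 ⟸ crux: feed the crux the CONSTANT curve at `d` (tame on the sole end of `d`). [folklore] -/
theorem christodoulouAtKerrEndedData_of_crux (hG : CensorshipAlongKerrEnds) :
    Goal.stub_christodoulouAtKerrEndedData := by
  intro X _ _ _ _ _ _ d hd hK _hC
  obtain ⟨-, e, M, hsole, hdecay⟩ := id hd
  have h := (censorshipAlongKerrEnds_iff.1 hG) X e (fun _ ↦ d)
    (InitialDataSet.isTameDataFamily_const hsole 1 hdecay) (Or.inr fun _ ↦ rfl) (fun _ ↦ hd)
    (fun _ _ ↦ hK)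
  exact localEscape_of_goodCurveThrough h

/-- Stub 3 ⟸ crux: feed the crux the given curve. [folklore] -/
theorem censoredKerrEndedLanding_of_crux (hG : CensorshipAlongKerrEnds) :
    Goal.stub_censoredKerrEndedLanding := by
  intro X _ _ _ _ _ _ e F hF himm hinj h𝓓 hKE _hK
  exact localEscape_of_goodCurveThrough
    ((censorshipAlongKerrEnds_iff.1 hG) X e F hF (Or.inl ⟨himm, hinj⟩) h𝓓 hKE)

/-- LOSSLESSNESS modulo the bookkeeping stub: given Stub 1, the crux is equivalent to the conjunction of
the two physical stubs. [folklore] -/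
theorem censorshipAlongKerrEnds_iff_pieces (h₁ : Goal.stub_windowUpgrade) :
    CensorshipAlongKerrEnds ↔
      Goal.stub_christodoulouAtKerrEndedData ∧ Goal.stub_censoredKerrEndedLanding :=
  ⟨fun hG ↦ ⟨christodoulouAtKerrEndedData_of_crux hG, censoredKerrEndedLanding_of_crux hG⟩,
    fun h ↦ censorshipAlongKerrEnds_of_pieces h₁ h.1 h.2⟩

/-- **The Christodoulou `𝓐_d`-form suffices for Stub 2** (PROVED bookkeeping): if through every admissible
Kerr-ended non-censored `d` passes a jointly smooth one-parameter family, immersed at `0`, `F' 0 = d`,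
all of whose members agree with `d` off ONE compact set, and whose members with `0 < ‖c‖ < ε` solve the
vacuum constraints and are censored, then Stub 2 holds: such a family is tame on a collared restriction of
the sole end of `d` (`isTameDataFamily_restrict_of_agree_off_compact_one`), its members are admissible
(`mem_admissibleVacuumData_of_agree_off_compact`) and Kerr-ended (`kerrEnded_of_agree_off_compact`).
[cite: Christodoulou1999, p. A24] -/
theorem christodoulouAtKerrEndedData_of_compactSupport
    (h : ∀ (X : Type) [TopologicalSpace X] [ChartedSpace Literature.Geometry.Lorentzian.E3 X] [IsManifold (𝓡 3) ((⊤ : ℕ∞) : WithTop ℕ∞) X] [T2Space X] [SecondCountableTopology X] [ConnectedSpace X], let KerrEnded : Literature.Geometry.Lorentzian.InitialDataSet (𝓡 3) X → Prop := fun D ↦ ∀ [Literature.Geometry.Lorentzian.Kerr.Facts], ∃ (K : Set X) (U : Opens Literature.Geometry.Lorentzian.E3) (M a r₀ : ℝ) (hM : 0 ≤ M) (φ : U → X) (ψ : U → Literature.Geometry.Lorentzian.Kerr.region a r₀) (ν : Literature.Geometry.Lorentzian.NormalField 𝓘(ℝ, Literature.Geometry.Lorentzian.E4) ψ), IsCompact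 K ∧ Kᶜ ⊆ range φ ∧ Topology.IsOpenEmbedding φ ∧ ContMDiff 𝓘(ℝ, Literature.Geometry.Lorentzian.E3) (𝓡 3) ((⊤ : ℕ∞) : WithTop ℕ∞) φ ∧ Injective ψ ∧ (Literature.Geometry.Lorentzian.Kerr.smoothMetric M a r₀).IsSpacelikeImmersion 𝓘(ℝ, Literature.Geometry.Lorentzian.E3) ψ ∧ (Literature.Geometry.Lorentzian.Kerr.smoothMetric M a r₀).IsFutureUnitNormal 𝓘(ℝ, Literature.Geometry.Lorentzian.E3) ((Literature.Geometry.Lorentzian.Kerr.timeOrientation M a r₀ hM).ofLE le_top) ψ ν ∧ (∀ (y : U) (v w : Literature.Geometry.Lorentzian.E3), φ y ∉ K → D.h.inner (φ y) (mfderiv 𝓘(ℝ, Literature.Geometry.Lorentzian.E3) (𝓡 3) φ y v) (mfderiv 𝓘(ℝ, Literature.Geometry.Lorentzian.E3) (𝓡 3) φ y w) = Literature.Geometry.Lorentzian.Kerr.bilin M a (ψ y : Literature.Geometry.Lorentzian.E4) (mfderiv 𝓘(ℝ, Literature.Geometry.Lorentzian.E3) 𝓘(ℝ, Literature.Geometry.Lorentzian.E4)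 ψ y v) (mfderiv 𝓘(ℝ, Literature.Geometry.Lorentzian.E3) 𝓘(ℝ, Literature.Geometry.Lorentzian.E4) ψ y w)) ∧ (∀ [(Literature.Geometry.Lorentzian.Kerr.smoothMetric M a r₀).HasLeviCivita] (y : U) (v w : Literature.Geometry.Lorentzian.E3), φ y ∉ K → D.k (φ y) (mfderiv 𝓘(ℝ, Literature.Geometry.Lorentzian.E3) (𝓡 3) φ y v) (mfderiv 𝓘(ℝ, Literature.Geometry.Lorentzian.E3) (𝓡 3) φ y w) = (Literature.Geometry.Lorentzian.Kerr.smoothMetric M a r₀).secondFundamentalForm 𝓘(ℝ, Literature.Geometry.Lorentzian.E3) ψ ν y v w); let Censored : Literature.Geometry.Lorentzian.InitialDataSet (𝓡 3) X → Prop := fun D ↦ ∀ 𝒟 : Literature.Geometry.Lorentzian.VacuumCauchyDevelopment D, 𝒟.IsMaximal → Summit.FinalStateConjecture.HasCompleteNullInfinity 𝒟.toCauchyDevelopment; ∀ d ∈ Literature.Geometry.Lorentzian.admissibleVacuumData X, KerrEnded d → ¬ Censored d → ∃ F' : EuclideanSpace ℝ (Fin 1) → Literature.Geometry.Lorentzian.InitialDataSet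 (𝓡 3) X, Literature.Geometry.Lorentzian.InitialDataSet.IsSmoothDataFamily 1 F' ∧ Literature.Geometry.Lorentzian.InitialDataSet.IsImmersedAtZero 1 F' ∧ F' 0 = d ∧ (∃ K₀ : Set X, IsCompact K₀ ∧ ∀ c, ∀ x ∉ K₀, (F' c).h.inner x = d.h.inner x ∧ (F' c).k x = d.k x) ∧ ∃ ε > (0 : ℝ), ∀ c, c ≠ 0 → ‖c‖ < ε → (∀ [(F' c).metric.HasLeviCivita], (F' c).IsVacuumConstraintSolution) ∧ Censored (F' c)) :
    Goal.stub_christodoulouAtKerrEndedData := by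
  intro X _ _ _ _ _ _ d hd hK hC
  obtain ⟨F', hsm, himm, h0, ⟨K₀, hK₀, hagree⟩, ε, hε, hP⟩ := h X d hd hK hC
  obtain ⟨-, e, M, hsole, hdecay⟩ := id hd
  have hR₁ : e.R < e.R + 1 := by linarith
  have hagree0 : ∀ c, ∀ x ∉ K₀, (F' c).h.inner x = (F' 0).h.inner x ∧ (F' c).k x = (F' 0).k x := by
    intro c x hx
    rw [h0]
    exact hagree c x hx
  have hdecay0 : e.IsStronglyAsymptoticallyFlatDR (F' 0) M := by
    rw [h0]
    exact hdecay
  refine ⟨e.restrict hR₁.le, F',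
    InitialDataSet.isTameDataFamily_restrict_of_agree_off_compact_one hsm hsole hdecay0 hK₀ hagree0 hR₁,
    himm, h0, ε, hε, fun c hc hcε ↦ ⟨?_, ?_, (hP c hc hcε).2⟩⟩
  · exact InitialDataSet.mem_admissibleVacuumData_of_agree_off_compact hd (hP c hc hcε).1 hK₀ (hagree c)
  · exact kerrEnded_of_agree_off_compact hK hK₀ (hagree c)

end Summit.FinalStateConjecture.FinalStateConjecture.Cruxes.CensorshipAlongKerrEnds.BasePointReduction

end
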